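import Summits.ValiantsHypothesis.ValiantsHypothesis.Theorems.LacunarySymmetroidMatrixDescartesDoorA26WallBubblingFrameTail

/-!
# Wall bubbling for `DoorA26` — WEYL QUADRUPLES: heads of the low class moments and the linear dependence of a four-letter frame

HONEST FRAMING.  Chain lemmas toward `TripleStratum26` of `Cruxes/DoorA26/Lines/wall_bubbling_ConfluentDoor.lean` (rev 13; crux `DoorA26`,
stmt-ValiantsHypothesis-19979 — OPEN, typed, never asserted), pattern [4,1,1] (a quadruple is a triple).  W1 seat val-sym-door-p2 g15 (#93a).
ALGEBRA ONLY (def-free), inputs of the four-letter rigidity dichotomy (#93 `…WeylQuadDichotomy`):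

* `quadHead_filter`, `quadHead_eval` — the HEAD index sets `{i ≤ m : i < 4 ∧ m − i < 4}` of #92 `blockMoment_head` for `m ≤ 6` and `m = 9`, and the
  heads written out: `G₀₀`, `2G₀₁`, `2G₀₂+2G₁₁`, `2G₀₃+6G₁₂`, `8G₁₃+6G₂₂`, `20G₂₃`, `20G₃₃`, and `0` for `m = 9` (the tenth slot has NO head);
* `symm_frame_dependent` — four symmetric `2 × 2` real matrices are linearly dependent (coordinates in `ℝ³`, `Module.finrank_fin_fun`): a
  max-normalised `c` with `Σ_i c_i·polar(Y, T_i) = 0` for every `Y`.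

Nothing here bears on `DoorA26`, `MatrixDescartes` (stmt-ValiantsHypothesis-18050) or `VP ≠ VNP`; `TripleStratum26`, (W), (M) OPEN.
`--supports stmt-ValiantsHypothesis-19979 --as helper`.  [folklore].
-/

-- `Summit.ValiantsHypothesis.ValiantsHypothesis.…` repeats a component by the D-0017 layout
-- (single-conjunct summit), which the `dupNamespace` linter flags; the name is mandated.
set_option linter.dupNamespace false

namespace Summit.ValiantsHypothesis.ValiantsHypothesis.Theorems.LacunarySymmetroidMatrixDescartes.WallBubbling

open Finset Filter Topology
open Bubbling (polar polar_apply)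
open scoped BigOperators

/-! ## 1. The heads of the low moments of a four-letter block -/

/-- The head index sets `{i ≤ m : i < 4 ∧ m − i < 4}` for `m ≤ 6` and `m = 9`. [folklore] -/
theorem quadHead_filter :
    ((Finset.range 1).filter (fun i => i < 4 ∧ 0 - i < 4) = {0}) ∧
    ((Finset.range 2).filter (fun i => i < 4 ∧ 1 - i < 4) = {0, 1}) ∧
    ((Finset.range 3).filter (fun i => i < 4 ∧ 2 - i < 4) = {0, 1, 2}) ∧
    ((Finset.range 4).filter (fun i => i < 4 ∧ 3 - i < 4) = {0, 1, 2, 3}) ∧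
    ((Finset.range 5).filter (fun i => i < 4 ∧ 4 - i < 4) = {1, 2, 3}) ∧
    ((Finset.range 6).filter (fun i => i < 4 ∧ 5 - i < 4) = {2, 3}) ∧
    ((Finset.range 7).filter (fun i => i < 4 ∧ 6 - i < 4) = {3}) ∧
    ((Finset.range 10).filter (fun i => i < 4 ∧ 9 - i < 4) = ∅) := by
  refine ⟨by decide, by decide, by decide, by decide, by decide, by decide, by decide, by decide⟩

/-- The heads written out: `m = 0..6` and `9`, for any symmetric kernel `G`. [folklore] -/
theorem quadHead_eval (G : ℕ → ℕ → ℝ) (hG : ∀ i j, G i j = G j i) :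
    (∑ i ∈ (Finset.range 1).filter (fun i => i < 4 ∧ 0 - i < 4), ((0 : ℕ).choose i : ℝ) * G i (0 - i)) = G 0 0 ∧
    (∑ i ∈ (Finset.range 2).filter (fun i => i < 4 ∧ 1 - i < 4), ((1 : ℕ).choose i : ℝ) * G i (1 - i)) = 2 * G 0 1 ∧
    (∑ i ∈ (Finset.range 3).filter (fun i => i < 4 ∧ 2 - i < 4), ((2 : ℕ).choose i : ℝ) * G i (2 - i)) = 2 * G 0 2 + 2 * G 1 1 ∧
    (∑ i ∈ (Finset.range 4).filter (fun i => i < 4 ∧ 3 - i < 4), ((3 : ℕ).choose i : ℝ) * G i (3 - i)) = 2 * G 0 3 + 6 * G 1 2 ∧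
    (∑ i ∈ (Finset.range 5).filter (fun i => i < 4 ∧ 4 - i < 4), ((4 : ℕ).choose i : ℝ) * G i (4 - i)) = 8 * G 1 3 + 6 * G 2 2 ∧
    (∑ i ∈ (Finset.range 6).filter (fun i => i < 4 ∧ 5 - i < 4), ((5 : ℕ).choose i : ℝ) * G i (5 - i)) = 20 * G 2 3 ∧
    (∑ i ∈ (Finset.range 7).filter (fun i => i < 4 ∧ 6 - i < 4), ((6 : ℕ).choose i : ℝ) * G i (6 - i)) = 20 * G 3 3 ∧
    (∑ i ∈ (Finset.range 10).filter (fun i => i < 4 ∧ 9 - i < 4), ((9 : ℕ).choose i : ℝ) * G i (9 - i)) = 0 := by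
  obtain ⟨h0, h1, h2, h3, h4, h5, h6, h9⟩ := quadHead_filter
  have c42 : ((4 : ℕ).choose 2 : ℝ) = 6 := by norm_num [Nat.choose]
  have c52 : ((5 : ℕ).choose 2 : ℝ) = 10 := by norm_num [Nat.choose]
  have c53 : ((5 : ℕ).choose 3 : ℝ) = 10 := by norm_num [Nat.choose]
  have c63 : ((6 : ℕ).choose 3 : ℝ) = 20 := by norm_num [Nat.choose]
  refine ⟨?_, ?_, ?_, ?_, ?_, ?_, ?_, ?_⟩
  · rw [h0, Finset.sum_singleton]; simp
  · rw [h1, Finset.sum_insert (by decide), Finset.sum_singleton]; simp [hG 1 0]; ring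
  · rw [h2, Finset.sum_insert (by decide), Finset.sum_insert (by decide), Finset.sum_singleton]
    simp [hG 2 0]; ring
  · rw [h3, Finset.sum_insert (by decide), Finset.sum_insert (by decide), Finset.sum_insert (by decide), Finset.sum_singleton]
    simp [hG 3 0, hG 2 1]; ring
  · rw [h4, Finset.sum_insert (by decide), Finset.sum_insert (by decide), Finset.sum_singleton]
    simp [hG 3 1, c42]; ring
  · rw [h5, Finset.sum_insert (by decide), Finset.sum_singleton]
    simp [hG 3 2, c52, c53]; ring
  · rw [h6, Finset.sum_singleton]
    simp [c63]
  · rw [h9, Finset.sum_empty]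

/-! ## 2. Four symmetric matrices are linearly dependent -/

/-- **Four symmetric `2 × 2` real matrices are linearly dependent**: there is a max-normalised `c` (some `|c_i| = 1`, all `|c_i| ≤ 1`) with
`Σ_i c_i • T_i = 0`, hence `Σ_i c_i · polar(Y, T_i) = 0` for every `Y`. [folklore] -/
theorem symm_frame_dependent (T : Fin 4 → Matrix (Fin 2) (Fin 2) ℝ) (hT : ∀ i, (T i).IsSymm) :
    ∃ c : Fin 4 → ℝ, (∀ i, |c i| ≤ 1) ∧ (∃ i, |c i| = 1) ∧ ∀ Y : Matrix (Fin 2) (Fin 2) ℝ, ∑ i, c i * polar Y (T i) = 0 := by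
  classical
  -- coordinates in `ℝ³`
  set f : Fin 4 → (Fin 3 → ℝ) := fun i => ![T i 0 0, T i 0 1, T i 1 1] with hf
  have hdep : ¬ LinearIndependent ℝ f := by
    intro hli
    have := hli.fintype_card_le_finrank
    rw [Module.finrank_fin_fun, Fintype.card_fin] at this
    omega
  obtain ⟨g, hg, i₀, hi₀⟩ := Fintype.not_linearIndependent_iff.mp hdep
  -- normalise by the largest modulus
  set μ : ℝ := (univ : Finset (Fin 4)).sup' Finset.univ_nonempty (fun i => |g i|) with hμ
  have hdom : ∀ i, |g i| ≤ μ := fun i => Finset.le_sup' (fun i => |g i|) (Finset.mem_univ i)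
  obtain ⟨i₁, _, hi₁⟩ := Finset.exists_mem_eq_sup' (Finset.univ_nonempty (α := Fin 4)) (fun i => |g i|)
  have hμpos : 0 < μ := lt_of_lt_of_le (abs_pos.mpr hi₀) (hdom i₀)
  refine ⟨fun i => g i / μ, fun i => ?_, ⟨i₁, ?_⟩, fun Y => ?_⟩
  · rw [abs_div, abs_of_pos hμpos, div_le_one hμpos]; exact hdom i
  · rw [abs_div, abs_of_pos hμpos, ← hi₁, div_self (ne_of_gt hμpos)]
  · -- the relation, entrywise, gives `Σ c_i T_i = 0` on the three free entries; polar is linear in them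
    have hent : ∀ k : Fin 3, ∑ i, g i * f i k = 0 := by
      intro k
      have := congrFun hg k
      simpa [Finset.sum_apply, Pi.smul_apply, smul_eq_mul] using this
    have h00 : ∑ i, g i * T i 0 0 = 0 := by simpa [hf] using hent 0
    have h01 : ∑ i, g i * T i 0 1 = 0 := by simpa [hf] using hent 1
    have h11 : ∑ i, g i * T i 1 1 = 0 := by simpa [hf] using hent 2
    have h10 : ∀ i, T i 1 0 = T i 0 1 := fun i => (hT i).apply 0 1
    have hsum : ∑ i, g i * polar Y (T i) = 0 := by
      have hrw : ∀ i, g i * polar Y (T i)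
          = (Y 1 1 / 2) * (g i * T i 0 0) + (Y 0 0 / 2) * (g i * T i 1 1) - ((Y 0 1 + Y 1 0) / 2) * (g i * T i 0 1) := by
        intro i; rw [polar_apply, h10]; ring
      simp only [hrw, Finset.sum_sub_distrib, Finset.sum_add_distrib, ← Finset.mul_sum, h00, h01, h11]
      ring
    have : ∑ i, g i / μ * polar Y (T i) = (∑ i, g i * polar Y (T i)) / μ := by
      rw [Finset.sum_div]; exact Finset.sum_congr rfl fun i _ => by ring
    rw [this, hsum, zero_div]


end Summit.ValiantsHypothesis.ValiantsHypothesis.Theorems.LacunarySymmetroidMatrixDescartes.WallBubbling
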